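import Mathlib
import Literature.MathematicalPhysics.QuantumManyBody.BoseEinsteinCondensation
import Summits.AtomisticToContinuum.BoseEinsteinCondensation.Theorems.SoloBlindTrialStateCriterion
import Summits.AtomisticToContinuum.BoseEinsteinCondensation.Theorems.SoloBlindJastrowPlateau

/-!
# Jastrow-type trial states at density `ρ` condense with fraction `≥ (1 − (4π/3) ρ R³)²`

Solo seat `solo-AtomisticToContinuum-blind`, conjunct `BoseEinsteinCondensation`.

The `N`-uniform rung in the conjunct's own terms.  `volume_box`: `|Λ_L| = L³` (measurability of
the box is already in the tree and is re-derived inline where needed).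
`TrialState.mul_sq_le_maxOccupation_of_jastrow_factor`: for a bosonic Dirichlet trial state
`Ψ : TrialState (n+1) (sideLength ρ (n+1))` (so `(n+1)/L³ = ρ`) whose wave function is real,
nonnegative and of Jastrow type in the first particle,
`Ψ(x :: Y) = 1_{Λ_L}(x) · ∏ⱼ f(x − Yⱼ) · F(Y)` with `0 ≤ f ≤ 1`, `f = 1` outside radius `R ≥ 0`,
`F ≥ 0`, one has
`(n+1) · (1 − ρ · (4π/3) R³)² ≤ maxOccupation (n+1) Ψ.ψ`
— a macroscopic occupation of the uniform mode, uniformly in `n`, as soon as `(4π/3) ρ R³ < 1`.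
-/

open MeasureTheory
open scoped ENNReal

namespace Summit.AtomisticToContinuum.BoseEinsteinCondensation.Theorems

open Literature.MathematicalPhysics.QuantumManyBody.BoseGas

/-- The box `Λ_L` is the preimage of the cube `(0,L)³` under the coordinate map. -/
theorem box_eq_preimage (L : ℝ) :
    box L = (@WithLp.ofLp 2 (Fin 3 → ℝ)) ⁻¹' Set.univ.pi fun _ => Set.Ioo 0 L := by
  ext x
  simp [box, Set.mem_pi]

/-- **`|Λ_L| = L³`.** -/
theorem volume_box (L : ℝ) : volume (box L) = ENNReal.ofReal L ^ 3 := by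
  rw [box_eq_preimage, (PiLp.volume_preserving_ofLp (Fin 3)).measure_preimage
    (MeasurableSet.univ_pi fun _ => measurableSet_Ioo).nullMeasurableSet, volume_pi_pi]
  simp [Real.volume_Ioo, Finset.prod_const]

namespace TrialState

/-- **Jastrow-type trial states at density `ρ` condense, uniformly in the particle number.** -/
theorem mul_sq_le_maxOccupation_of_jastrow_factor {n : ℕ} {ρ : ℝ} (hρ : 0 < ρ)
    (Ψ : TrialState (n + 1) (sideLength ρ (n + 1)))
    {f : Space → ℝ} {R : ℝ} (hR : 0 ≤ R) (hf0 : 0 ≤ f) (hf1 : f ≤ 1)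
    (hfR : ∀ x, R ≤ ‖x‖ → f x = 1)
    {F : Config n → ℝ} (hF0 : 0 ≤ F) {Φ : Config (n + 1) → ℝ}
    (hΨΦ : Ψ.ψ = fun X => (Φ X : ℂ))
    (hprod : ∀ Y x, Φ (Matrix.vecCons x Y) =
      (box (sideLength ρ (n + 1))).indicator (fun _ => (1 : ℝ)) x *
        (∏ j : Fin n, f (x - Y j)) * F Y) :
    (n + 1 : ℝ≥0∞) * (1 - ENNReal.ofReal (ρ * (4 / 3 * Real.pi * R ^ 3))) ^ 2 ≤
      maxOccupation (n + 1) Ψ.ψ := by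
  have hN : (0 : ℝ) < (n + 1 : ℕ) := by exact_mod_cast Nat.succ_pos n
  have hLpos : 0 < sideLength ρ (n + 1) := by
    rw [sideLength]
    exact Real.rpow_pos_of_pos (div_pos hN hρ) _
  have hL3 : ρ * sideLength ρ (n + 1) ^ 3 = (n + 1 : ℕ) := by
    have h := div_sideLength_pow_three hρ (Nat.succ_pos n)
    have hL3ne : sideLength ρ (n + 1) ^ 3 ≠ 0 := pow_ne_zero 3 hLpos.ne'
    field_simp at h
    linarith [h]
  -- nonnegativity and normalisation of `Φ`
  have hΦ0 : 0 ≤ Φ := by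
    intro X
    have hX : X = Matrix.vecCons (X 0) (Matrix.vecTail X) := (Matrix.cons_head_tail X).symm
    rw [Pi.zero_apply, hX, hprod]
    refine mul_nonneg (mul_nonneg (Set.indicator_nonneg (fun _ _ => zero_le_one) _)
      (Finset.prod_nonneg fun j _ => hf0 _)) (hF0 _)
  have hΦm : Measurable Φ := measurable_of_eq_ofReal Ψ hΨΦ
  have hΦ1 := lintegral_lintegral_sq_eq_one Ψ hΦ0 hΨΦ
  -- the box
  have hS : MeasurableSet (box (sideLength ρ (n + 1))) := by
    rw [box_eq_preimage]
    exact (PiLp.volume_preserving_ofLp (Fin 3)).measurable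
      (MeasurableSet.univ_pi fun _ => measurableSet_Ioo)
  have hvol : volume (box (sideLength ρ (n + 1))) = ENNReal.ofReal (sideLength ρ (n + 1) ^ 3) := by
    rw [volume_box, ENNReal.ofReal_pow hLpos.le]
  have hS0 : volume (box (sideLength ρ (n + 1))) ≠ 0 := by
    rw [hvol]
    exact (ENNReal.ofReal_pos.mpr (pow_pos hLpos 3)).ne'
  have hStop : volume (box (sideLength ρ (n + 1))) ≠ ⊤ := by
    rw [hvol]
    exact ENNReal.ofReal_ne_top
  have hmain := Theorems.mul_sq_le_maxOccupation_of_jastrow_factor hS hS0 hStop hf0 hf1 hfR hF0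
    hΦm hΦ1 hprod
  rw [hΨΦ]
  refine le_trans (mul_le_mul' le_rfl (pow_le_pow_left' (tsub_le_tsub_left ?_ _) 2)) hmain
  -- density bookkeeping: `n |B_R| / L³ ≤ ρ (4π/3) R³`
  have hball : volume (Metric.ball (0 : Space) R) = ENNReal.ofReal (4 / 3 * Real.pi * R ^ 3) := by
    rw [EuclideanSpace.volume_ball_fin_three, ← ENNReal.ofReal_pow hR, ← ENNReal.ofReal_mul
      (pow_nonneg hR 3)]
    congr 1
    ring
  rw [hball, hvol, ENNReal.div_le_iff (by rw [← hvol]; exact hS0) ENNReal.ofReal_ne_top]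
  have hn : (n : ℝ≥0∞) ≤ ENNReal.ofReal ρ * ENNReal.ofReal (sideLength ρ (n + 1) ^ 3) := by
    rw [← ENNReal.ofReal_mul hρ.le, hL3, ENNReal.ofReal_natCast]
    exact_mod_cast Nat.le_succ n
  calc (n : ℝ≥0∞) * ENNReal.ofReal (4 / 3 * Real.pi * R ^ 3)
      ≤ ENNReal.ofReal ρ * ENNReal.ofReal (sideLength ρ (n + 1) ^ 3) *
          ENNReal.ofReal (4 / 3 * Real.pi * R ^ 3) := mul_le_mul' hn le_rfl
    _ = ENNReal.ofReal (ρ * (4 / 3 * Real.pi * R ^ 3)) *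
          ENNReal.ofReal (sideLength ρ (n + 1) ^ 3) := by
        rw [ENNReal.ofReal_mul hρ.le]
        ring

end TrialState

end Summit.AtomisticToContinuum.BoseEinsteinCondensation.Theorems
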